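import Literature.NumberTheory.EllipticCurves.RootNumberTableThreeKodairaProofs
import Literature.NumberTheory.EllipticCurves.RootNumberTableThreeKodairaRowsProofs
import Literature.NumberTheory.EllipticCurves.QuadraticTwistTateFormTwoProofs
import Literature.NumberTheory.EllipticCurves.BSDSelmerSmithNoRationalTwoTorsionCMProofs
import Mathlib.NumberTheory.Padics.HeightOneSpectrum
import HarnessLib

/-!
# The Kodaira symbol at `3` of the Mordell curves `y² = x³ + k` (every `k ∈ ℤ ∖ {0}`, every model),
# by Tate's algorithm run in the kernel (Rizzo's Table II = Papadopoulos's Table III at `p = 3`)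

`Proofs`-style file (THEOREMS ONLY: no definition, no named fact, no instance), topic
`Literature/NumberTheory/EllipticCurves`. Cell `bsd-print-cf2`, seat ty2 (discharge interface of the
line `route-BirchSwinnertonDyer-CMKolyvaginAtInertTwo`, whose habitat `H₂` carries the binder
`Odd W.tamagawaProduct` on the `j = 0` class); HONEST FRAMING: a textbook local computation, nothing
about BSD is asserted or booked.

Write `k = 3ᵃ·u` with `3 ∤ u`. The equation `y² = x³ + k` has `c₄ = 0`, `c₆ = −864k = 3^{a+3}·(−32u)`,
`Δ = −432k² = −3^{2a+3}·16u²`, so `(v₃ c₄, v₃ c₆, v₃ Δ) = (∞, a + 3, 2a + 3)` and the prime-to-`3` part of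
`c₆` is `c₆' = −32u ≡ 4u (mod 9)`. Rescaling by `3^{⌊a/6⌋}` one may take `a < 6`; the Kod column of
O. G. Rizzo, Compositio Math. 136 (2003), Table II (p. 4) — which the tree PROVES equal to Tate's
algorithm at `3` for every equation over `ℚ` (`kodairaSymbolAt_eq_tableKodairaSymbolThree_of_primesEquiv_eq`,
`RootNumberTableThreeKodairaProofs`) — then reads, with the special condition
`c₆'² + 2 ≡ 3c_{4,e} = 0 (mod 9)`, i.e. `4u ≡ ±4`, i.e. **`u ≡ ±1 (mod 9)`**:

| `a mod 6` | reduced triple | row of Table II | Kodaira symbol |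
|---|---|---|---|
| `0` | `(∞, 3, 3)` | `(≥2,3,3)` | **`III`** if `u ≡ ±1 (mod 9)`, else **`II`** |
| `1` | `(∞, 4, 5)` | `(≥3,4,5)` | **`II`** |
| `2` | `(∞, 5, 7)` | `(≥4,5,7)` | **`IV`** |
| `3` | `(∞, 6, 9)` | `(≥4,6,9)` / `(≥5,6,9)` | **`III*`** if `u ≡ ±1 (mod 9)`, else **`IV*`** |
| `4` | `(∞, 7, 11)` | `(≥5,7,11)` | **`IV*`** |
| `5` | `(∞, 8, 13)` → ★`(∞, 2, 1)` | `(≥2,2,1)` | **`II*`** |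

(The same values follow from Silverman's Steps 1–10 by hand: for `a = 0` the singular point is
`(−u, 0)`, `a₆ ↦ u − u³ = −(u−1)u(u+1)`, so Step 3 exits with II unless `9 ∣ u² − 1`, and then
`v₃(b₈) = 2` gives III; for `a = 3`, after `x ↦ x − 3u`, Step 8's quadratic is `Y² − a₆/3⁴` with
`a₆ = 27u(1 − u²)`, giving IV* unless `9 ∣ u² − 1`, and then Step 9 gives III*.)

## What is here (`u ∈ ℤ`, `3 ∤ u`; §3: any `k ≠ 0`, any `W` with `C • W = (y² = x³ + k)`, `v ∣ 3`)

* §1 invariants and `3`-adic readings of `y² = x³ + 3ⁱu`: `val3 c₄ = ⊤`, `val3 c₆ = i + 3`,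
  `v₃(Δ) = 2i + 3`, `res9 c₆ = (−32u) mod 9`, and `(−32u mod 9)² + 2 ≡ 0 (mod 9) ⟺ u ≡ ±1 (mod 9)`.
* §2 the six rows: `tableKodairaSymbolThree` of `y² = x³ + 3ⁱu`, `i = 0, …, 5`.
* §3 transport to every model of `y² = x³ + k`, `k = 3ᵃu` arbitrary: rescaling
  `(3^m, 0, 0, 0) • (y² = x³ + 3^{6m}b) = (y² = x³ + b)`, `kodairaSymbolAt_smul'`, and the eight
  theorems `kodairaSymbolAt_three_of_mordell_*` keyed by `a mod 6` and `u mod 9`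
  (`a = k.natAbs.factorization 3`, `u = k / 3ᵃ`).

## References

* O. G. Rizzo, *Average root numbers for a nonconstant family of elliptic curves*, Compositio
  Math. 136 (2003) 1–23, §1.1–1.2 and Table II (p. 4), column Kod. [Rizzo2003]
* I. Papadopoulos, *Sur la classification de Néron des courbes elliptiques en caractéristique
  résiduelle 2 et 3*, J. Number Theory 44 (1993) 119–152, Table III (`p = 3`). [Papadopoulos1993]
* J. H. Silverman, *Advanced Topics in the Arithmetic of Elliptic Curves*, GTM 151 (1994), IV.9.4
  Steps 1–10 and Table 4.1. [SilvermanATAEC1994]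
-/

set_option autoImplicit false

noncomputable section

open scoped Classical NumberField

open WeierstrassCurve NumberField IsDedekindDomain IsDedekindDomain.HeightOneSpectrum
  Rat.HeightOneSpectrum Literature.NumberTheory.EllipticCurves
  Literature.NumberTheory.EllipticCurves.Rizzo

namespace Literature.NumberTheory.EllipticCurves.Mordell

/-! ## §1 Invariants of `y² = x³ + k` and their `3`-adic readings -/

section Invariants

/-- `c₄(y² = x³ + k) = 0` (the tree's `P2.c₄_mk_a₆`, Summits side). [cite: SilvermanAEC2009, III.1 (formulas for c₄)] -/
private theorem c₄_mordell (k : ℚ) : (⟨0, 0, 0, 0, k⟩ : WeierstrassCurve ℚ).c₄ = 0 := by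
  simp only [WeierstrassCurve.c₄, WeierstrassCurve.b₂, WeierstrassCurve.b₄]
  ring

/-- `c₆(y² = x³ + k) = −864k` (the tree's `P2.c₆_mk_a₆`, Summits side). [cite: SilvermanAEC2009, III.1 (formulas for c₆)] -/
private theorem c₆_mordell (k : ℚ) : (⟨0, 0, 0, 0, k⟩ : WeierstrassCurve ℚ).c₆ = -864 * k := by
  simp only [WeierstrassCurve.c₆, WeierstrassCurve.b₂, WeierstrassCurve.b₄, WeierstrassCurve.b₆]
  ring

/-- `Δ(y² = x³ + k) = −432k²`. [cite: SilvermanAEC2009, III.1 (formula for Δ)] -/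
private theorem Δ_mordell (k : ℚ) : (⟨0, 0, 0, 0, k⟩ : WeierstrassCurve ℚ).Δ = -432 * k ^ 2 := by
  simp only [WeierstrassCurve.Δ, WeierstrassCurve.b₂, WeierstrassCurve.b₄, WeierstrassCurve.b₆,
    WeierstrassCurve.b₈]
  ring

/-- `c₆(y² = x³ + 3ⁱu) = 3^{i+3} · (−32u)`. [cite: SilvermanAEC2009, III.1 (formulas for c₆)] -/
theorem c₆_mordell_pow_mul (i : ℕ) (u : ℤ) :
    (⟨0, 0, 0, 0, (((3 : ℤ) ^ i * u : ℤ) : ℚ)⟩ : WeierstrassCurve ℚ).c₆ =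
      (3 : ℚ) ^ (i + 3) * ((-32 * u : ℤ) : ℚ) := by
  rw [c₆_mordell]; push_cast; ring

/-- `Δ(y² = x³ + 3ⁱu) = −(3^{2i+3} · 16u²)`. [cite: SilvermanAEC2009, III.1 (formula for Δ)] -/
theorem Δ_mordell_pow_mul (i : ℕ) (u : ℤ) :
    (⟨0, 0, 0, 0, (((3 : ℤ) ^ i * u : ℤ) : ℚ)⟩ : WeierstrassCurve ℚ).Δ =
      -((3 : ℚ) ^ (2 * i + 3) * ((16 * u ^ 2 : ℤ) : ℚ)) := by
  rw [Δ_mordell]; push_cast; ring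

/-- `padicValRat 3 z = 0` for an integer `z` prime to `3`. [folklore] -/
private theorem padicValRat_three_intCast_eq_zero {z : ℤ} (hz : ¬ (3 : ℤ) ∣ z) :
    padicValRat 3 (z : ℚ) = 0 := by
  rw [padicValRat.of_int, Nat.cast_eq_zero]
  exact padicValInt.eq_zero_of_not_dvd hz

/-- `padicValRat 3 (3ⁿ·z) = n` for an integer `z ≠ 0` prime to `3`. [folklore] -/
private theorem padicValRat_three_pow_mul_intCast {z : ℤ} (hz0 : z ≠ 0) (hz : ¬ (3 : ℤ) ∣ z) (n : ℕ) :
    padicValRat 3 ((3 : ℚ) ^ n * (z : ℚ)) = n := by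
  haveI : Fact (Nat.Prime 3) := ⟨Nat.prime_three⟩
  rw [padicValRat.mul (pow_ne_zero _ (by norm_num)) (Int.cast_ne_zero.mpr hz0), padicValRat.pow,
    padicValRat_three_intCast_eq_zero hz,
    show (3 : ℚ) = ((3 : ℕ) : ℚ) by norm_num, padicValRat.self (by norm_num)]
  simp

variable {i : ℕ} {u : ℤ}

/-- `3 ∤ −32u` for `3 ∤ u`. [folklore] -/
private theorem not_three_dvd_c₆' (hu : ¬ (3 : ℤ) ∣ u) : ¬ (3 : ℤ) ∣ -32 * u := by
  intro h
  rcases (Int.prime_three.dvd_mul).mp h with h | h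
  · norm_num at h
  · exact hu h

/-- `3 ∤ 16u²` for `3 ∤ u`. [folklore] -/
private theorem not_three_dvd_Δ' (hu : ¬ (3 : ℤ) ∣ u) : ¬ (3 : ℤ) ∣ 16 * u ^ 2 := by
  intro h
  rcases (Int.prime_three.dvd_mul).mp h with h | h
  · norm_num at h
  · exact hu (Int.prime_three.dvd_of_dvd_pow h)

/-- `v₃(c₆(y² = x³ + 3ⁱu)) = i + 3` (`3 ∤ u`, `u ≠ 0`). [cite: Rizzo2003, §1.1 (p. 3)] -/
theorem padicValRat_three_c₆ (hu0 : u ≠ 0) (hu : ¬ (3 : ℤ) ∣ u) :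
    padicValRat 3 (⟨0, 0, 0, 0, (((3 : ℤ) ^ i * u : ℤ) : ℚ)⟩ : WeierstrassCurve ℚ).c₆ = (i + 3 : ℕ) := by
  rw [c₆_mordell_pow_mul]
  exact padicValRat_three_pow_mul_intCast (mul_ne_zero (by norm_num) hu0) (not_three_dvd_c₆' hu) _

/-- `v₃(Δ(y² = x³ + 3ⁱu)) = 2i + 3` (`3 ∤ u`, `u ≠ 0`). [cite: Rizzo2003, §1.1 (p. 3)] -/
theorem padicValRat_three_Δ (hu0 : u ≠ 0) (hu : ¬ (3 : ℤ) ∣ u) :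
    padicValRat 3 (⟨0, 0, 0, 0, (((3 : ℤ) ^ i * u : ℤ) : ℚ)⟩ : WeierstrassCurve ℚ).Δ = (2 * i + 3 : ℕ) := by
  rw [Δ_mordell_pow_mul, padicValRat.neg]
  exact padicValRat_three_pow_mul_intCast (mul_ne_zero (by norm_num) (pow_ne_zero _ hu0))
    (not_three_dvd_Δ' hu) _

/-- `v₃(c₄) = ∞` (`c₄ = 0`), in the table's `WithTop ℤ`. [cite: Rizzo2003, §1.1 (p. 3)] -/
theorem val3_c₄ (k : ℚ) : val3 (⟨0, 0, 0, 0, k⟩ : WeierstrassCurve ℚ).c₄ = ⊤ := by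
  rw [c₄_mordell, val3, if_pos rfl]

/-- `v₃(c₆) = i + 3` in the table's `WithTop ℤ`. [cite: Rizzo2003, §1.1 (p. 3)] -/
theorem val3_c₆ (hu0 : u ≠ 0) (hu : ¬ (3 : ℤ) ∣ u) :
    val3 (⟨0, 0, 0, 0, (((3 : ℤ) ^ i * u : ℤ) : ℚ)⟩ : WeierstrassCurve ℚ).c₆ =
      (((i + 3 : ℕ) : ℤ) : WithTop ℤ) := by
  have hne : (⟨0, 0, 0, 0, (((3 : ℤ) ^ i * u : ℤ) : ℚ)⟩ : WeierstrassCurve ℚ).c₆ ≠ 0 := by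
    rw [c₆_mordell_pow_mul]
    exact mul_ne_zero (pow_ne_zero _ (by norm_num))
      (Int.cast_ne_zero.mpr (mul_ne_zero (by norm_num) hu0))
  rw [val3, if_neg hne, padicValRat_three_c₆ hu0 hu]

/-- The prime-to-`3` part of `c₆` is the INTEGER `−32u`. [cite: Rizzo2003, p. 2 (notation x')] -/
theorem primeToThreePart_c₆ (hu0 : u ≠ 0) (hu : ¬ (3 : ℤ) ∣ u) :
    primeToThreePart (⟨0, 0, 0, 0, (((3 : ℤ) ^ i * u : ℤ) : ℚ)⟩ : WeierstrassCurve ℚ).c₆ =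
      ((-32 * u : ℤ) : ℚ) := by
  rw [primeToThreePart, padicValRat_three_c₆ hu0 hu, c₆_mordell_pow_mul, zpow_natCast,
    mul_div_cancel_left₀ _ (pow_ne_zero _ (by norm_num))]

/-- `c₆' mod 9 = (−32u) mod 9` as the table reads it (`res9`). [cite: Rizzo2003, p. 2 and Table II] -/
theorem res9_c₆ (hu0 : u ≠ 0) (hu : ¬ (3 : ℤ) ∣ u) :
    res9 (⟨0, 0, 0, 0, (((3 : ℤ) ^ i * u : ℤ) : ℚ)⟩ : WeierstrassCurve ℚ).c₆ = (-32 * u) % 9 := by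
  rw [res9, primeToThreePart_c₆ hu0 hu]
  simp only [Rat.den_intCast, Rat.num_intCast, if_true]

/-- `(−32u) mod 9` from `u mod 9`: `u ≡ 1, 8, 2, 7, 4, 5 ↦ 4, 5, 8, 1, 7, 2`. [folklore] -/
private theorem c₆'_emod_nine (u : ℤ) :
    (u % 9 = 1 → (-32 * u) % 9 = 4) ∧ (u % 9 = 8 → (-32 * u) % 9 = 5) ∧
    (u % 9 = 2 → (-32 * u) % 9 = 8) ∧ (u % 9 = 7 → (-32 * u) % 9 = 1) ∧
    (u % 9 = 4 → (-32 * u) % 9 = 7) ∧ (u % 9 = 5 → (-32 * u) % 9 = 2) := by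
  refine ⟨fun h => ?_, fun h => ?_, fun h => ?_, fun h => ?_, fun h => ?_, fun h => ?_⟩ <;>
    · rw [Int.mul_emod, h]; norm_num

/-- For `3 ∤ u`: `u mod 9 ∈ {1, 2, 4, 5, 7, 8}`. [folklore] -/
private theorem emod_nine_cases (hu : ¬ (3 : ℤ) ∣ u) :
    u % 9 = 1 ∨ u % 9 = 8 ∨ u % 9 = 2 ∨ u % 9 = 7 ∨ u % 9 = 4 ∨ u % 9 = 5 := by
  omega

/-- `res9 c₄ = res9 0`, so `c_{4,e} = 0` for every `e` (here `c₄ = 0`). [cite: Rizzo2003, p. 2 (notation c_{n,e})] -/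
theorem c4e_top_eq_zero (x : ℤ) (e : ℕ) : c4e ⊤ x e = 0 := rfl

/-- **Rizzo's special condition `c₆'² + 2 ≡ 3c_{4,e} (mod 9)` on `y² = x³ + 3ⁱu` HOLDS iff
`u ≡ ±1 (mod 9)`** (`c₄ = 0`, `c₆' ≡ −32u ≡ 4u`; `(4u)² ≡ 7 ⟺ u² ≡ 1 (mod 9)`).
[cite: Rizzo2003, Table II (p. 4), rows (≥2,3,3) and (≥4,6,9)] -/
theorem specialCondition_iff (hu : ¬ (3 : ℤ) ∣ u) (x : ℤ) (e : ℕ) :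
    decide ((((-32 * u) % 9) ^ 2 + 2) % 9 = 3 * c4e ⊤ x e % 9) = true ↔ (u % 9 = 1 ∨ u % 9 = 8) := by
  rw [decide_eq_true_iff, c4e_top_eq_zero]
  have h := c₆'_emod_nine u
  rcases emod_nine_cases hu with h9 | h9 | h9 | h9 | h9 | h9
  · rw [h.1 h9]; exact ⟨fun _ => Or.inl h9, fun _ => by decide⟩
  · rw [h.2.1 h9]; exact ⟨fun _ => Or.inr h9, fun _ => by decide⟩
  · rw [h.2.2.1 h9]; exact ⟨fun h' => absurd h' (by decide), fun h' => by omega⟩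
  · rw [h.2.2.2.1 h9]; exact ⟨fun h' => absurd h' (by decide), fun h' => by omega⟩
  · rw [h.2.2.2.2.1 h9]; exact ⟨fun h' => absurd h' (by decide), fun h' => by omega⟩
  · rw [h.2.2.2.2.2 h9]; exact ⟨fun h' => absurd h' (by decide), fun h' => by omega⟩

end Invariants

/-! ## §2 The six rows of Table II on `y² = x³ + 3ⁱu`, `i = 0, …, 5` -/

section Rows

variable {u : ℤ}

/-- **Row `(≥2,3,3)` with the special condition (`i = 0`, `u ≡ ±1 (mod 9)`): Kodaira `III`.**
[cite: Rizzo2003, Table II (p. 4), row (≥2,3,3)] [cite: Papadopoulos1993, Table III (p = 3)] -/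
theorem tableKodairaSymbolThree_zero_of_sp (hu0 : u ≠ 0) (h9 : u % 9 = 1 ∨ u % 9 = 8) :
    (⟨0, 0, 0, 0, (((3 : ℤ) ^ 0 * u : ℤ) : ℚ)⟩ : WeierstrassCurve ℚ).tableKodairaSymbolThree = .III := by
  have hu : ¬ (3 : ℤ) ∣ u := by omega
  rw [tableKodairaSymbolThree, kodairaOfInvariants_eq_of_shift_zero (a := ⊤)
    (b := ((3 : ℤ) : WithTop ℤ)) (c := 3) (k := 0) (by rw [val3_c₄]; rfl)
    (by rw [val3_c₆ hu0 hu]; simp) (by rw [padicValRat_three_Δ hu0 hu]; norm_num) (by decide),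
    res9_c₆ hu0 hu]
  exact kodaira_row_ge2_3_3_of_sp (a := ⊤) rfl _ _ _ ((specialCondition_iff hu _ 2).mpr h9)

/-- **Row `(≥2,3,3)` without the special condition (`i = 0`, `u ≢ ±1 (mod 9)`): Kodaira `II`.**
[cite: Rizzo2003, Table II (p. 4), row (≥2,3,3)] [cite: Papadopoulos1993, Table III (p = 3)] -/
theorem tableKodairaSymbolThree_zero_of_not_sp (hu0 : u ≠ 0) (hu : ¬ (3 : ℤ) ∣ u)
    (h9 : ¬ (u % 9 = 1 ∨ u % 9 = 8)) :
    (⟨0, 0, 0, 0, (((3 : ℤ) ^ 0 * u : ℤ) : ℚ)⟩ : WeierstrassCurve ℚ).tableKodairaSymbolThree = .II := by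
  rw [tableKodairaSymbolThree, kodairaOfInvariants_eq_of_shift_zero (a := ⊤)
    (b := ((3 : ℤ) : WithTop ℤ)) (c := 3) (k := 0) (by rw [val3_c₄]; rfl)
    (by rw [val3_c₆ hu0 hu]; simp) (by rw [padicValRat_three_Δ hu0 hu]; norm_num) (by decide),
    res9_c₆ hu0 hu]
  refine kodaira_row_ge2_3_3_of_not_sp (a := ⊤) rfl _ _ _ ?_
  rw [Bool.eq_false_iff]
  exact fun h => h9 ((specialCondition_iff hu _ 2).mp h)

/-- **Row `(≥3,4,5)` (`i = 1`): Kodaira `II`.** [cite: Rizzo2003, Table II (p. 4), row (≥3,4,5)]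
[cite: Papadopoulos1993, Table III (p = 3)] -/
theorem tableKodairaSymbolThree_one (hu0 : u ≠ 0) (hu : ¬ (3 : ℤ) ∣ u) :
    (⟨0, 0, 0, 0, (((3 : ℤ) ^ 1 * u : ℤ) : ℚ)⟩ : WeierstrassCurve ℚ).tableKodairaSymbolThree = .II := by
  rw [tableKodairaSymbolThree, kodairaOfInvariants_eq_of_shift_zero (a := ⊤)
    (b := ((4 : ℤ) : WithTop ℤ)) (c := 5) (k := 0) (by rw [val3_c₄]; rfl)
    (by rw [val3_c₆ hu0 hu]; simp) (by rw [padicValRat_three_Δ hu0 hu]; norm_num) (by decide)]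
  exact kodaira_row_ge3_4_5 (a := ⊤) rfl WithTop.top_ne_coe _ _ _

/-- **Row `(≥4,5,7)` (`i = 2`): Kodaira `IV`.** [cite: Rizzo2003, Table II (p. 4), row (≥4,5,7)]
[cite: Papadopoulos1993, Table III (p = 3)] -/
theorem tableKodairaSymbolThree_two (hu0 : u ≠ 0) (hu : ¬ (3 : ℤ) ∣ u) :
    (⟨0, 0, 0, 0, (((3 : ℤ) ^ 2 * u : ℤ) : ℚ)⟩ : WeierstrassCurve ℚ).tableKodairaSymbolThree = .IV := by
  rw [tableKodairaSymbolThree, kodairaOfInvariants_eq_of_shift_zero (a := ⊤)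
    (b := ((5 : ℤ) : WithTop ℤ)) (c := 7) (k := 0) (by rw [val3_c₄]; rfl)
    (by rw [val3_c₆ hu0 hu]; simp) (by rw [padicValRat_three_Δ hu0 hu]; norm_num) (by decide)]
  exact kodaira_row_ge4_5_7 (a := ⊤) rfl _ _ _

/-- **Row `(≥4,6,9)` with the special condition (`i = 3`, `u ≡ ±1 (mod 9)`): Kodaira `III*`.**
[cite: Rizzo2003, Table II (p. 4), row (≥4,6,9)] [cite: Papadopoulos1993, Table III (p = 3)] -/
theorem tableKodairaSymbolThree_three_of_sp (hu0 : u ≠ 0) (h9 : u % 9 = 1 ∨ u % 9 = 8) :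
    (⟨0, 0, 0, 0, (((3 : ℤ) ^ 3 * u : ℤ) : ℚ)⟩ : WeierstrassCurve ℚ).tableKodairaSymbolThree =
      .IIIstar := by
  have hu : ¬ (3 : ℤ) ∣ u := by omega
  rw [tableKodairaSymbolThree, kodairaOfInvariants_eq_of_shift_zero (a := ⊤)
    (b := ((6 : ℤ) : WithTop ℤ)) (c := 9) (k := 0) (by rw [val3_c₄]; rfl)
    (by rw [val3_c₆ hu0 hu]; simp) (by rw [padicValRat_three_Δ hu0 hu]; norm_num) (by decide),
    res9_c₆ hu0 hu]
  exact kodaira_row_ge4_6_9_of_sp (a := ⊤) rfl _ _ _ ((specialCondition_iff hu _ 4).mpr h9)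

/-- **Row `(≥5,6,9)` without the special condition (`i = 3`, `u ≢ ±1 (mod 9)`; the corrected clause
`c₆' ≢ ±4 (mod 9)` is the same condition here): Kodaira `IV*`.**
[cite: Rizzo2003, Table II (p. 4), row (≥5,6,9)] [cite: Varillyalvarado2011, Rem. 4.2]
[cite: Papadopoulos1993, Table III (p = 3)] -/
theorem tableKodairaSymbolThree_three_of_not_sp (hu0 : u ≠ 0) (hu : ¬ (3 : ℤ) ∣ u)
    (h9 : ¬ (u % 9 = 1 ∨ u % 9 = 8)) :
    (⟨0, 0, 0, 0, (((3 : ℤ) ^ 3 * u : ℤ) : ℚ)⟩ : WeierstrassCurve ℚ).tableKodairaSymbolThree =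
      .IVstar := by
  rw [tableKodairaSymbolThree, kodairaOfInvariants_eq_of_shift_zero (a := ⊤)
    (b := ((6 : ℤ) : WithTop ℤ)) (c := 9) (k := 0) (by rw [val3_c₄]; rfl)
    (by rw [val3_c₆ hu0 hu]; simp) (by rw [padicValRat_three_Δ hu0 hu]; norm_num) (by decide),
    res9_c₆ hu0 hu]
  have hsp : decide ((((-32 * u) % 9) ^ 2 + 2) % 9 = 3 * c4e ⊤ ((-32 * u) % 9) 4 % 9) = false := by
    rw [Bool.eq_false_iff]
    exact fun h => h9 ((specialCondition_iff hu _ 4).mp h)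
  have hy : ¬ ((-32 * u) % 9 % 9 = 4 ∨ (-32 * u) % 9 % 9 = 5) := by
    have h := c₆'_emod_nine u
    rcases emod_nine_cases hu with h1 | h1 | h1 | h1 | h1 | h1
    · exact absurd (Or.inl h1) h9
    · exact absurd (Or.inr h1) h9
    · rw [h.2.2.1 h1]; decide
    · rw [h.2.2.2.1 h1]; decide
    · rw [h.2.2.2.2.1 h1]; decide
    · rw [h.2.2.2.2.2 h1]; decide
  exact kodaira_row_ge5_6_9_of_not_sp (a := ⊤) rfl WithTop.top_ne_coe _ _ _
    (by rw [res9, c₄_mordell]; exact hsp) hy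

/-- **Row `(≥5,7,11)` (`i = 4`): Kodaira `IV*`.** [cite: Rizzo2003, Table II (p. 4), row (≥5,7,11)]
[cite: Papadopoulos1993, Table III (p = 3)] -/
theorem tableKodairaSymbolThree_four (hu0 : u ≠ 0) (hu : ¬ (3 : ℤ) ∣ u) :
    (⟨0, 0, 0, 0, (((3 : ℤ) ^ 4 * u : ℤ) : ℚ)⟩ : WeierstrassCurve ℚ).tableKodairaSymbolThree =
      .IVstar := by
  rw [tableKodairaSymbolThree, kodairaOfInvariants_eq_of_shift_zero (a := ⊤)
    (b := ((7 : ℤ) : WithTop ℤ)) (c := 11) (k := 0) (by rw [val3_c₄]; rfl)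
    (by rw [val3_c₆ hu0 hu]; simp) (by rw [padicValRat_three_Δ hu0 hu]; norm_num) (by decide)]
  exact kodaira_row_ge5_7_11 (a := ⊤) rfl WithTop.top_ne_coe _ _ _

/-- **Row ★`(≥2,2,1)` (`i = 5`: valuations `(∞, 8, 13)`, one rescaling above the reduced triple
`(∞, 2, 1)`): Kodaira `II*`.** [cite: Rizzo2003, Table II (p. 4), row (≥2,2,1)]
[cite: Papadopoulos1993, Table III (p = 3)] -/
theorem tableKodairaSymbolThree_five (hu0 : u ≠ 0) (hu : ¬ (3 : ℤ) ∣ u) :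
    (⟨0, 0, 0, 0, (((3 : ℤ) ^ 5 * u : ℤ) : ℚ)⟩ : WeierstrassCurve ℚ).tableKodairaSymbolThree =
      .IIstar := by
  rw [tableKodairaSymbolThree, kodairaOfInvariants_eq_of_shift_one (a := ⊤)
    (b := ((8 : ℤ) : WithTop ℤ)) (c := 13) (k := 0) (by rw [val3_c₄]; rfl)
    (by rw [val3_c₆ hu0 hu]; simp) (by rw [padicValRat_three_Δ hu0 hu]; norm_num) (by decide)]
  exact kodaira_row_ge2_2_1 (a := ⊤) rfl (by decide) (by decide) _ _ _

end Rows

/-! ## §3 Every model of `y² = x³ + k`, every `k ≠ 0` -/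

section Transport

variable (W : WeierstrassCurve ℚ) [W.IsElliptic] {C : VariableChange ℚ} {k : ℤ}
  (v : HeightOneSpectrum (𝓞 ℚ))

/-- Rescaling `(3^m, 0, 0, 0) • (y² = x³ + 3^{6m}·b) = (y² = x³ + b)`. [cite: SilvermanAEC2009, III.1 Table 3.1 (u⁻⁶a₆)] -/
theorem threePowScale_smul (m : ℕ) (b : ℚ) :
    (⟨Units.mk0 ((3 : ℚ) ^ m) (pow_ne_zero _ (by norm_num)), 0, 0, 0⟩ : VariableChange ℚ) •
        (⟨0, 0, 0, 0, (3 : ℚ) ^ (6 * m) * b⟩ : WeierstrassCurve ℚ) = ⟨0, 0, 0, 0, b⟩ := by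
  have h6 : ((3 : ℚ) ^ m) ^ 6 = 3 ^ (6 * m) := by rw [← pow_mul, mul_comm]
  ext <;> simp [WeierstrassCurve.variableChange_a₁, WeierstrassCurve.variableChange_a₂,
    WeierstrassCurve.variableChange_a₃, WeierstrassCurve.variableChange_a₄,
    WeierstrassCurve.variableChange_a₆]
  rw [h6, inv_mul_cancel_left₀ (pow_ne_zero _ (by norm_num))]

/-- `k = 3^{6⌊a/6⌋} · (3^{a mod 6} · u)` with `a = v₃(k)`, `u = k / 3ᵃ` (`k ≠ 0`), `3 ∤ u`, `u ≠ 0`.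
[folklore] -/
private theorem exists_eq_pow_mul_of_ne_zero (hk : k ≠ 0) :
    let a := k.natAbs.factorization 3
    (k : ℚ) = (3 : ℚ) ^ (6 * (a / 6)) * (((3 : ℤ) ^ (a % 6) * (k / 3 ^ a) : ℤ) : ℚ) ∧
      ¬ (3 : ℤ) ∣ k / 3 ^ a ∧ k / 3 ^ a ≠ 0 := by
  intro a
  have hdvd : (3 : ℤ) ^ a ∣ k := by
    have : ((3 ^ a : ℕ) : ℤ) ∣ k := Int.natCast_dvd.mpr (Nat.ordProj_dvd k.natAbs 3)
    exact_mod_cast this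
  obtain ⟨u, hu⟩ := hdvd
  have h3a : (3 : ℤ) ^ a ≠ 0 := pow_ne_zero _ (by norm_num)
  have hdiv : k / 3 ^ a = u := by rw [hu]; exact Int.mul_ediv_cancel_left _ h3a
  have hu0 : u ≠ 0 := by rintro rfl; exact hk (by rw [hu, mul_zero])
  have hu3 : ¬ (3 : ℤ) ∣ u := by
    rintro ⟨w, rfl⟩
    have h1 : (3 : ℤ) ^ (a + 1) ∣ k := ⟨w, by rw [hu]; ring⟩
    have h2 : 3 ^ (a + 1) ∣ k.natAbs := by
      have := Int.natAbs_dvd_natAbs.mpr h1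
      rwa [Int.natAbs_pow] at this
    have := (Nat.prime_three.pow_dvd_iff_le_factorization (Int.natAbs_ne_zero.mpr hk)).mp h2
    change a + 1 ≤ a at this
    omega
  refine ⟨?_, by rwa [hdiv], by rwa [hdiv]⟩
  rw [hdiv, hu]
  push_cast
  rw [← mul_assoc, ← pow_add, Nat.div_add_mod]

/-- **The Kodaira symbol at `3` of every model of `y² = x³ + k` is Table II's Kod entry for the
reduced equation `y² = x³ + 3^{a mod 6}u`** (`a = v₃(k)`, `u = k/3ᵃ`): rescaling + Tate = Table II
(`kodairaSymbolAt_eq_tableKodairaSymbolThree_of_primesEquiv_eq`) + model-independence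
(`kodairaSymbolAt_smul'`). [cite: Rizzo2003, §1.1–1.2 and Table II (p. 4)]
[cite: SilvermanATAEC1994, IV.9.4 and Table 4.1] -/
theorem kodairaSymbolAt_three_of_mordell_eq_table (hM : C • W = ⟨0, 0, 0, 0, (k : ℚ)⟩) (hk : k ≠ 0)
    (hv : natGenerator v = 3) :
    W.kodairaSymbolAt v =
      (⟨0, 0, 0, 0, (((3 : ℤ) ^ (k.natAbs.factorization 3 % 6) *
        (k / 3 ^ k.natAbs.factorization 3) : ℤ) : ℚ)⟩ : WeierstrassCurve ℚ).tableKodairaSymbolThree := by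
  obtain ⟨hkb, -, hu0⟩ := exists_eq_pow_mul_of_ne_zero hk
  set a := k.natAbs.factorization 3 with ha
  set b : ℤ := (3 : ℤ) ^ (a % 6) * (k / 3 ^ a) with hb
  haveI : PerfectField (IsLocalRing.ResidueField (v.adicCompletionIntegers ℚ)) := PerfectField.ofFinite
  have hbz : b ≠ 0 := mul_ne_zero (pow_ne_zero _ (by norm_num)) hu0
  have hb0 : (b : ℚ) ≠ 0 := Int.cast_ne_zero.mpr hbz
  haveI : (⟨0, 0, 0, 0, (b : ℚ)⟩ : WeierstrassCurve ℚ).IsElliptic := isElliptic_of_j_zero_model hb0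
  set D : VariableChange ℚ := ⟨Units.mk0 ((3 : ℚ) ^ (a / 6)) (pow_ne_zero _ (by norm_num)), 0, 0, 0⟩
    with hD
  have hDM : (D * C) • W = ⟨0, 0, 0, 0, (b : ℚ)⟩ := by
    rw [mul_smul, hM, hkb, hD, threePowScale_smul]
  rw [← kodairaSymbolAt_smul' v W (D * C), hDM]
  exact kodairaSymbolAt_eq_tableKodairaSymbolThree_of_primesEquiv_eq v _ hv

/-- **`y² = x³ + k` at `3`, `v₃(k) ≡ 0 (mod 6)`, `u ≡ ±1 (mod 9)`: Kodaira type `III`** (every model;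
`u = k/3^{v₃(k)}`). [cite: Rizzo2003, Table II (p. 4), row (≥2,3,3)]
[cite: SilvermanATAEC1994, IV.9.4 Step 4 and Table 4.1] -/
theorem kodairaSymbolAt_three_of_mordell_zero_of_sp (hM : C • W = ⟨0, 0, 0, 0, (k : ℚ)⟩) (hk : k ≠ 0)
    (hv : natGenerator v = 3) (ha : k.natAbs.factorization 3 % 6 = 0)
    (h9 : k / 3 ^ k.natAbs.factorization 3 % 9 = 1 ∨ k / 3 ^ k.natAbs.factorization 3 % 9 = 8) :
    W.kodairaSymbolAt v = .III := by
  obtain ⟨-, -, hu0⟩ := exists_eq_pow_mul_of_ne_zero hk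
  rw [kodairaSymbolAt_three_of_mordell_eq_table W v hM hk hv, ha]
  exact tableKodairaSymbolThree_zero_of_sp hu0 h9

/-- **`y² = x³ + k` at `3`, `v₃(k) ≡ 0 (mod 6)`, `u ≢ ±1 (mod 9)`: Kodaira type `II`** (every model).
[cite: Rizzo2003, Table II (p. 4), row (≥2,3,3)] [cite: SilvermanATAEC1994, IV.9.4 Step 3 and Table 4.1] -/
theorem kodairaSymbolAt_three_of_mordell_zero_of_not_sp (hM : C • W = ⟨0, 0, 0, 0, (k : ℚ)⟩)
    (hk : k ≠ 0) (hv : natGenerator v = 3) (ha : k.natAbs.factorization 3 % 6 = 0)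
    (h9 : ¬ (k / 3 ^ k.natAbs.factorization 3 % 9 = 1 ∨ k / 3 ^ k.natAbs.factorization 3 % 9 = 8)) :
    W.kodairaSymbolAt v = .II := by
  obtain ⟨-, hu3, hu0⟩ := exists_eq_pow_mul_of_ne_zero hk
  rw [kodairaSymbolAt_three_of_mordell_eq_table W v hM hk hv, ha]
  exact tableKodairaSymbolThree_zero_of_not_sp hu0 hu3 h9

/-- **`y² = x³ + k` at `3`, `v₃(k) ≡ 1 (mod 6)`: Kodaira type `II`** (every model).
[cite: Rizzo2003, Table II (p. 4), row (≥3,4,5)] [cite: SilvermanATAEC1994, IV.9.4 Step 3 and Table 4.1] -/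
theorem kodairaSymbolAt_three_of_mordell_one (hM : C • W = ⟨0, 0, 0, 0, (k : ℚ)⟩) (hk : k ≠ 0)
    (hv : natGenerator v = 3) (ha : k.natAbs.factorization 3 % 6 = 1) :
    W.kodairaSymbolAt v = .II := by
  obtain ⟨-, hu3, hu0⟩ := exists_eq_pow_mul_of_ne_zero hk
  rw [kodairaSymbolAt_three_of_mordell_eq_table W v hM hk hv, ha]
  exact tableKodairaSymbolThree_one hu0 hu3

/-- **`y² = x³ + k` at `3`, `v₃(k) ≡ 2 (mod 6)`: Kodaira type `IV`** (every model).
[cite: Rizzo2003, Table II (p. 4), row (≥4,5,7)] [cite: SilvermanATAEC1994, IV.9.4 Step 5 and Table 4.1] -/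
theorem kodairaSymbolAt_three_of_mordell_two (hM : C • W = ⟨0, 0, 0, 0, (k : ℚ)⟩) (hk : k ≠ 0)
    (hv : natGenerator v = 3) (ha : k.natAbs.factorization 3 % 6 = 2) :
    W.kodairaSymbolAt v = .IV := by
  obtain ⟨-, hu3, hu0⟩ := exists_eq_pow_mul_of_ne_zero hk
  rw [kodairaSymbolAt_three_of_mordell_eq_table W v hM hk hv, ha]
  exact tableKodairaSymbolThree_two hu0 hu3

/-- **`y² = x³ + k` at `3`, `v₃(k) ≡ 3 (mod 6)`, `u ≡ ±1 (mod 9)`: Kodaira type `III*`** (every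
model). [cite: Rizzo2003, Table II (p. 4), row (≥4,6,9)] [cite: SilvermanATAEC1994, IV.9.4 Step 9 and Table 4.1] -/
theorem kodairaSymbolAt_three_of_mordell_three_of_sp (hM : C • W = ⟨0, 0, 0, 0, (k : ℚ)⟩) (hk : k ≠ 0)
    (hv : natGenerator v = 3) (ha : k.natAbs.factorization 3 % 6 = 3)
    (h9 : k / 3 ^ k.natAbs.factorization 3 % 9 = 1 ∨ k / 3 ^ k.natAbs.factorization 3 % 9 = 8) :
    W.kodairaSymbolAt v = .IIIstar := by
  obtain ⟨-, -, hu0⟩ := exists_eq_pow_mul_of_ne_zero hk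
  rw [kodairaSymbolAt_three_of_mordell_eq_table W v hM hk hv, ha]
  exact tableKodairaSymbolThree_three_of_sp hu0 h9

/-- **`y² = x³ + k` at `3`, `v₃(k) ≡ 3 (mod 6)`, `u ≢ ±1 (mod 9)`: Kodaira type `IV*`** (every
model). [cite: Rizzo2003, Table II (p. 4), row (≥5,6,9)] [cite: SilvermanATAEC1994, IV.9.4 Step 8 and Table 4.1] -/
theorem kodairaSymbolAt_three_of_mordell_three_of_not_sp (hM : C • W = ⟨0, 0, 0, 0, (k : ℚ)⟩)
    (hk : k ≠ 0) (hv : natGenerator v = 3) (ha : k.natAbs.factorization 3 % 6 = 3)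
    (h9 : ¬ (k / 3 ^ k.natAbs.factorization 3 % 9 = 1 ∨ k / 3 ^ k.natAbs.factorization 3 % 9 = 8)) :
    W.kodairaSymbolAt v = .IVstar := by
  obtain ⟨-, hu3, hu0⟩ := exists_eq_pow_mul_of_ne_zero hk
  rw [kodairaSymbolAt_three_of_mordell_eq_table W v hM hk hv, ha]
  exact tableKodairaSymbolThree_three_of_not_sp hu0 hu3 h9

/-- **`y² = x³ + k` at `3`, `v₃(k) ≡ 4 (mod 6)`: Kodaira type `IV*`** (every model).
[cite: Rizzo2003, Table II (p. 4), row (≥5,7,11)] [cite: SilvermanATAEC1994, IV.9.4 Step 8 and Table 4.1] -/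
theorem kodairaSymbolAt_three_of_mordell_four (hM : C • W = ⟨0, 0, 0, 0, (k : ℚ)⟩) (hk : k ≠ 0)
    (hv : natGenerator v = 3) (ha : k.natAbs.factorization 3 % 6 = 4) :
    W.kodairaSymbolAt v = .IVstar := by
  obtain ⟨-, hu3, hu0⟩ := exists_eq_pow_mul_of_ne_zero hk
  rw [kodairaSymbolAt_three_of_mordell_eq_table W v hM hk hv, ha]
  exact tableKodairaSymbolThree_four hu0 hu3

/-- **`y² = x³ + k` at `3`, `v₃(k) ≡ 5 (mod 6)`: Kodaira type `II*`** (every model).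
[cite: Rizzo2003, Table II (p. 4), row (≥2,2,1)] [cite: SilvermanATAEC1994, IV.9.4 Step 10 and Table 4.1] -/
theorem kodairaSymbolAt_three_of_mordell_five (hM : C • W = ⟨0, 0, 0, 0, (k : ℚ)⟩) (hk : k ≠ 0)
    (hv : natGenerator v = 3) (ha : k.natAbs.factorization 3 % 6 = 5) :
    W.kodairaSymbolAt v = .IIstar := by
  obtain ⟨-, hu3, hu0⟩ := exists_eq_pow_mul_of_ne_zero hk
  rw [kodairaSymbolAt_three_of_mordell_eq_table W v hM hk hv, ha]
  exact tableKodairaSymbolThree_five hu0 hu3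

/-- **Summary at `3`: every model of `y² = x³ + k` is of type III or III* iff
`v₃(k) ≡ 0 (mod 3)` and `u ≡ ±1 (mod 9)`; otherwise it is of type II, IV, IV* or II*.**
[cite: Rizzo2003, Table II (p. 4)] [cite: SilvermanATAEC1994, IV.9.4 and Table 4.1] -/
theorem kodairaSymbolAt_three_of_mordell_cases (hM : C • W = ⟨0, 0, 0, 0, (k : ℚ)⟩) (hk : k ≠ 0)
    (hv : natGenerator v = 3) :
    ((k.natAbs.factorization 3 % 3 = 0 ∧
        (k / 3 ^ k.natAbs.factorization 3 % 9 = 1 ∨ k / 3 ^ k.natAbs.factorization 3 % 9 = 8)) →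
      W.kodairaSymbolAt v = .III ∨ W.kodairaSymbolAt v = .IIIstar) ∧
    (¬ (k.natAbs.factorization 3 % 3 = 0 ∧
        (k / 3 ^ k.natAbs.factorization 3 % 9 = 1 ∨ k / 3 ^ k.natAbs.factorization 3 % 9 = 8)) →
      W.kodairaSymbolAt v = .II ∨ W.kodairaSymbolAt v = .IV ∨ W.kodairaSymbolAt v = .IVstar ∨
        W.kodairaSymbolAt v = .IIstar) := by
  set a := k.natAbs.factorization 3 with ha
  refine ⟨fun ⟨h3, h9⟩ => ?_, fun hno => ?_⟩
  · rcases (show a % 6 = 0 ∨ a % 6 = 3 by omega) with h0 | h0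
    · exact Or.inl (kodairaSymbolAt_three_of_mordell_zero_of_sp W v hM hk hv h0 h9)
    · exact Or.inr (kodairaSymbolAt_three_of_mordell_three_of_sp W v hM hk hv h0 h9)
  · rcases (show a % 6 = 0 ∨ a % 6 = 1 ∨ a % 6 = 2 ∨ a % 6 = 3 ∨ a % 6 = 4 ∨ a % 6 = 5 by omega)
      with h0 | h0 | h0 | h0 | h0 | h0
    · have h9 : ¬ (k / 3 ^ a % 9 = 1 ∨ k / 3 ^ a % 9 = 8) := fun h9 => hno ⟨by omega, h9⟩
      exact Or.inl (kodairaSymbolAt_three_of_mordell_zero_of_not_sp W v hM hk hv h0 h9)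
    · exact Or.inl (kodairaSymbolAt_three_of_mordell_one W v hM hk hv h0)
    · exact Or.inr (Or.inl (kodairaSymbolAt_three_of_mordell_two W v hM hk hv h0))
    · have h9 : ¬ (k / 3 ^ a % 9 = 1 ∨ k / 3 ^ a % 9 = 8) := fun h9 => hno ⟨by omega, h9⟩
      exact Or.inr (Or.inr (Or.inl
        (kodairaSymbolAt_three_of_mordell_three_of_not_sp W v hM hk hv h0 h9)))
    · exact Or.inr (Or.inr (Or.inl (kodairaSymbolAt_three_of_mordell_four W v hM hk hv h0)))
    · exact Or.inr (Or.inr (Or.inr (kodairaSymbolAt_three_of_mordell_five W v hM hk hv h0)))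

end Transport

end Literature.NumberTheory.EllipticCurves.Mordell

end
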